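import Literature.AlgebraicGeometry.HodgeTheory.FermatZeroPoints
import Literature.AlgebraicGeometry.HodgeTheory.AffineLineBundleCohomology
import Literature.AlgebraicGeometry.Motives.TensorCentreHosts
import Literature.AlgebraicGeometry.Motives.PointSubcentres
import Literature.AlgebraicGeometry.Motives.AlgPointsProperProofs
import Literature.NumberTheory.Transcendental.AnalytificationSeparatedProofs
import HarnessLib

/-!
# Shioda–Katsura's blow-up with its exceptional hosts, packaged for the inductive step

Topic `Literature/AlgebraicGeometry/HodgeTheory`; theorem-only. For the Fermat curve `X¹ₘ`, a
smooth projective `W`, a smooth projective `X₁` with an effective Cartier ideal `K₁` (the ideal of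
a smooth divisor `g' : Y' ↪ X₁`) whose support is covered by finitely many disjoint closed
immersions `g_s : B₁ ↪ X₁` from one smooth projective `B₁`, we assemble the blow-up
`b : Z → X₁ ⊗ (X¹ₘ ⊗ W)` of `X₁ ⊗ X¹ₘ ⊗ W` along the product centre
`pr₁⁻¹K₁ + pr₂⁻¹ ker(fermatSection ▷ W)` (= `V(K₁) × X⁰ₘ × W`) together with its exceptional
hosts `E_{s,t} → B₁ ⊗ W` over the components `g_s(B₁) × {pₜ} × W` of the centre, in exactly the
shape consumed by `FermatHodgeClassesLiftOfBlowupGeometry` (`…_of_blowupGeometry₃`): `Z` smooth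
projective, `b` birational and an isomorphism off the centre, the hosts smooth projective
`ℙ¹`-bundles (flat, with closed sections) embedded in `Z` with disjoint images covering the
exceptional locus, and the cohomology of each host off its section pulled back from the base
(`HodgeTheory/AffineLineBundleCohomology`). This is Shioda–Katsura, Tôhoku Math. J. 31 (1979),
Thm. 1.7 with (1.6) and §2 Lemma 2.1, for `X₁ = Xʳ⁺¹ₘ ⊃ Xʳₘ` (`r ≥ 1`, one `g`) and for
`X₁ = X¹ₘ ⊃ X⁰ₘ` (`r = 0`, `g_s` the `m` points).

## References

* T. Shioda, T. Katsura, On Fermat varieties, Tôhoku Math. J. 31 (1979) 97–115, §1 (1.6),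
  Thm. 1.7, §2 Lemma 2.1. [ShiodaKatsura1979]
-/

noncomputable section

open CategoryTheory CategoryTheory.Limits AlgebraicGeometry MonoidalCategory

namespace Literature.AlgebraicGeometry.HodgeTheory

open Literature.AlgebraicGeometry.Motives Literature.AlgebraicGeometry.Resolution

variable {m : ℕ}

/-! ## The second factor: the Fermat curve with its `m` points, times `W` -/

section SecondFactor

variable (hm : 1 ≤ m) (W : SchemeOver ℂ)

/-- `ker (fermatSection ▷ W) = pr₁⁻¹ ker (fermatSection) · 𝒪` on `X¹ₘ ⊗ W`. [folklore] -/
theorem ker_fermatSection_whiskerRight (k₀ : Fin 3) :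
    ((fermatSection (Nat.one_le_iff_ne_zero.mp hm) k₀ : (fermatHypersurface 0 m) ⟶ fermatHypersurface 1 m) ▷ W).left.ker =
      (fermatSection (Nat.one_le_iff_ne_zero.mp hm) k₀).left.ker.comap
        (pullback.fst (fermatHypersurface 1 m).hom W.hom) :=
  ker_whiskerRight_left _ W

/-- **`ker (fermatSection ▷ W)` is an effective Cartier divisor on `X¹ₘ ⊗ W`.**
[cite: ShiodaKatsura1979, §1 (1.4)] -/
theorem isEffectiveCartier_ker_fermatSection_whiskerRight (k₀ : Fin 3) :
    IsEffectiveCartier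
      ((fermatSection (Nat.one_le_iff_ne_zero.mp hm) k₀ : (fermatHypersurface 0 m) ⟶ fermatHypersurface 1 m) ▷ W).left.ker := by
  rw [ker_fermatSection_whiskerRight hm W k₀]
  exact isEffectiveCartier_comap_fst (fermatHypersurface 1 m) _ (isEffectiveCartier_ker_fermatSection hm k₀) W

/-- The slice `{q} × W` over a rational point `q` of the curve killed by `ker (fermatSection)` is
killed by `ker (fermatSection ▷ W)`. [cite: ShiodaKatsura1979, §1 (1.6)] -/
theorem comap_slice_ker_fermatSection_whiskerRight (k₀ : Fin 3) (q : Spec (.of ℂ) ⟶ (fermatHypersurface 1 m).left)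
    (hq : q ≫ (fermatHypersurface 1 m).hom = 𝟙 _)
    (hqK : (fermatSection (Nat.one_le_iff_ne_zero.mp hm) k₀).left.ker.comap q = ⊥) :
    ((fermatSection (Nat.one_le_iff_ne_zero.mp hm) k₀ : (fermatHypersurface 0 m) ⟶ fermatHypersurface 1 m) ▷ W).left.ker.comap
      (pullback.lift (W.hom ≫ q) (𝟙 W.left) (slice_condition q hq W)) = ⊥ := by
  rw [ker_fermatSection_whiskerRight hm W k₀]
  exact comap_slice_eq_bot q hq W _ hqK

/-- The support of `ker (fermatSection k₀ ▷ W)` is `pr₁⁻¹ Z_{k₀}`. [folklore] -/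
theorem support_ker_fermatSection_whiskerRight (k₀ : Fin 3) :
    ((((fermatSection (Nat.one_le_iff_ne_zero.mp hm) k₀ : (fermatHypersurface 0 m) ⟶ fermatHypersurface 1 m) ▷ W).left.ker).support :
      Set ((fermatHypersurface (0 + 1) m) ⊗ W).left) =
      pullback.fst (fermatHypersurface 1 m).hom W.hom ⁻¹' fermatCoordHyperplane 1 m k₀ := by
  haveI : IsClosedImmersion
      ((fermatSection (Nat.one_le_iff_ne_zero.mp hm) k₀ : (fermatHypersurface 0 m) ⟶ fermatHypersurface 1 m) ▷ W).left := by
    rw [← tensorHom_id]; exact isClosedImmersion_tensorHom_left _ (𝟙 W)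
  rw [Scheme.Hom.support_ker, range_whiskerRight_left, range_fermatSection,
    IsClosed.closure_eq]
  exact (isClosed_fermatCoordHyperplane (N := 1) (m := m) k₀).preimage (Scheme.Hom.continuous _)

/-- Membership form of `support_ker_fermatSection_whiskerRight`. [folklore] -/
theorem mem_support_ker_fermatSection_whiskerRight (k₀ : Fin 3)
    (y : ((fermatHypersurface (0 + 1) m) ⊗ W).left) :
    y ∈ (((fermatSection (Nat.one_le_iff_ne_zero.mp hm) k₀ : (fermatHypersurface 0 m) ⟶ fermatHypersurface 1 m) ▷ W).left.ker).support ↔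
      pullback.fst (fermatHypersurface 1 m).hom W.hom y ∈ fermatCoordHyperplane 1 m k₀ := by
  rw [← SetLike.mem_coe, support_ker_fermatSection_whiskerRight hm W k₀]
  exact Iff.rfl

end SecondFactor

/-! ## The package -/

section Package

/-- **Shioda–Katsura's blow-up `Z → X₁ ⊗ X¹ₘ ⊗ W` along `V(K₁) × X⁰ₘ × W` with its exceptional
hosts**, packaged: `Z` smooth projective of dimension `dim X₁ + 1 + dim W`; `b` the blowing up,
birational and an isomorphism over the complement `U` of the centre; the hosts
`E_{s,t} = Z ×_{X₁ ⊗ X¹ₘ ⊗ W} (g_s(B₁) × {p_t} × W) → B₁ ⊗ W` (indexed by the components `g_s` of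
`V(K₁)` and the `m` points `p_t` of `X⁰ₘ`) smooth projective of dimension `dim B₁ + dim W + 1`,
flat with closed sections `σ`, closed in `Z` with pairwise disjoint images covering `Z ∖ b⁻¹U`,
sitting in the cartesian squares `j ≫ b = π ≫ (g_s ⊗ slice_t)`, and with
`H*(E_{s,t} ∖ σ) ← H*(B₁ ⊗ W)` "surjective" in the sense of
`HodgeTheory/AffineLineBundleCohomology`. [cite: ShiodaKatsura1979, §1 (1.6), Thm. 1.7 and §2 Lemma 2.1] -/
theorem exists_fermatBlowupHosts (hm : 1 ≤ m) {w : ℕ} (W : SchemeOver ℂ) (hW : IsSmoothProjective w W)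
    {X₁ Y' B₁ : SchemeOver ℂ} {n₁ d' d₁ : ℕ} (hX₁ : IsSmoothProjective n₁ X₁)
    (K₁ : X₁.left.IdealSheafData) (hK₁c : IsEffectiveCartier K₁)
    (hK₁ne : (K₁.support : Set X₁.left) ≠ Set.univ) (g' : Y' ⟶ X₁) [IsClosedImmersion g'.left]
    [SmoothOfRelativeDimension d' Y'.hom] (hK₁g' : K₁ = g'.left.ker) (hB₁ : IsSmoothProjective d₁ B₁)
    {S : Type} [Fintype S] (g : S → (B₁ ⟶ X₁)) [∀ s, IsClosedImmersion (g s).left]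
    (hgK : ∀ s, K₁.comap (g s).left = ⊥)
    (hgdisj : Pairwise fun s s' ↦ Disjoint (Set.range (g s).left) (Set.range (g s').left))
    (hgcov : (K₁.support : Set X₁.left) ⊆ ⋃ s, Set.range (g s).left) :
    ∃ (Z : SchemeOver ℂ) (_ : IsSmoothProjective (n₁ + (1 + w)) Z) (bb : Z ⟶ X₁ ⊗ ((fermatHypersurface 1 m) ⊗ W))
      (_ : IsBlowup bb.left (K₁.comap (pullback.fst X₁.hom ((fermatHypersurface 1 m) ⊗ W).hom) ⊔
        ((fermatSection (Nat.one_le_iff_ne_zero.mp hm) (Fin.last 2) : (fermatHypersurface 0 m) ⟶ fermatHypersurface 1 m) ▷ W).left.ker.comap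
          (pullback.snd X₁.hom ((fermatHypersurface 1 m) ⊗ W).hom)))
      (_ : IsBirational bb.left) (U : (X₁ ⊗ ((fermatHypersurface 1 m) ⊗ W)).left.Opens) (_ : IsIso (bb.left ∣_ U))
      (T : Type) (_ : Fintype T) (E : T → SchemeOver ℂ)
      (_ : ∀ t, IsSmoothProjective (d₁ + w + 1) (E t)) (π : ∀ t, E t ⟶ B₁ ⊗ W)
      (_ : ∀ t, Flat (π t).left) (σ : ∀ t, B₁ ⊗ W ⟶ E t) (_ : ∀ t, IsClosedImmersion (σ t).left)
      (j : ∀ t, E t ⟶ Z) (_ : ∀ t, IsClosedImmersion (j t).left)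
      (i : T → (B₁ ⊗ W ⟶ X₁ ⊗ ((fermatHypersurface 1 m) ⊗ W))) (_ : ∀ t, IsClosedImmersion (i t).left)
      (_ : ∀ t, j t ≫ bb = π t ≫ i t)
      (_ : Pairwise (Function.onFun Disjoint fun t ↦ Set.range (j t).left.base))
      (_ : ((bb.left ⁻¹ᵁ U : Z.left.Opens) : Set Z.left)ᶜ = ⋃ t, Set.range (j t).left.base),
      ∀ t (a : ℕ) (e : complexBetti (E t) a), ∃ p : complexBetti (B₁ ⊗ W) a,
        complexBetti.restrictCompl (E t) (Set.range (σ t).left.base) a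
          (e - complexBetti.map (π t) a p) = 0 := by
  classical
  have hm0 : m ≠ 0 := Nat.one_le_iff_ne_zero.mp hm
  -- the curve, its points, the second factor `X₂ = X¹ₘ ⊗ W`
  have h1 : IsSmoothProjective 1 (fermatHypersurface 1 m) :=
    SmoothHypersurface.isSmoothProjective_hypersurface_fermatPolynomial_of_charZero le_rfl hm
  haveI : IsProper (fermatHypersurface 1 m).hom := IsSmoothProjective.isProper_holds h1
  haveI : SmoothOfRelativeDimension 0 (fermatHypersurface 0 m).hom := smoothOfRelativeDimension_fermat_hom hm 0
  haveI := hW.smoothOfRelativeDimension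
  haveI : SmoothOfRelativeDimension (0 + w) ((fermatHypersurface 0 m) ⊗ W).hom :=
    smoothOfRelativeDimension_tensor 0 w (fermatHypersurface 0 m) W
  have hX₂ : IsSmoothProjective (1 + w) ((fermatHypersurface 1 m) ⊗ W) := IsSmoothProjective.tensor_holds h1 hW
  set fS₀ : (fermatHypersurface 0 m) ⟶ fermatHypersurface 1 m := fermatSection hm0 (Fin.last 2) with hfS₀
  haveI : IsClosedImmersion (fS₀ ▷ W).left := by
    rw [← tensorHom_id]; exact isClosedImmersion_tensorHom_left fS₀ (𝟙 W)
  set K₂ := (fS₀ ▷ W).left.ker with hK₂def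
  have hK₂c : IsEffectiveCartier K₂ := isEffectiveCartier_ker_fermatSection_whiskerRight hm W _
  -- the blowing up
  obtain ⟨Z, bb, hb, hZ, hbir, hiso⟩ := exists_isBlowup_tensorCentre_isSmoothProjective X₁ ((fermatHypersurface 1 m) ⊗ W)
    K₁ K₂ hX₁ hX₂ g' (fS₀ ▷ W) (d₁ := d') (d₂ := 0 + w) hK₁g' rfl hK₁ne
  haveI : IsProper Z.hom := IsSmoothProjective.isProper_holds hZ
  haveI hbsep : IsSeparated bb.left := by
    have : IsSeparated (bb.left ≫ (X₁ ⊗ ((fermatHypersurface 1 m) ⊗ W)).hom) := by rw [Over.w bb]; infer_instance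
    exact IsSeparated.of_comp bb.left (X₁ ⊗ ((fermatHypersurface 1 m) ⊗ W)).hom
  haveI : @IsSeparated Z.left (pullback X₁.hom ((fermatHypersurface 1 m) ⊗ W).hom) bb.left := hbsep
  -- the points of `X⁰ₘ` and the slices
  obtain ⟨T₀, _, q, hq1, hqK, hqinj, hqZ, hqcov⟩ := exists_fermatCurve_pointFamily hm (Fin.last 2)
  let hh : T₀ → (W ⟶ (fermatHypersurface 1 m) ⊗ W) := fun t ↦
    Over.homMk (pullback.lift (W.hom ≫ q t) (𝟙 W.left) (slice_condition (q t) (hq1 t) W))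
      (slice_comp_hom (q t) (hq1 t) W)
  haveI hhci : ∀ t, IsClosedImmersion (hh t).left := fun t ↦ isClosedImmersion_slice (q t) (hq1 t) W
  have hK₂h : ∀ t, K₂.comap (hh t).left = ⊥ := fun t ↦
    comap_slice_ker_fermatSection_whiskerRight hm W (Fin.last 2) (q t) (hq1 t) (hqK t)
  have hrange_hh : ∀ t, Set.range (hh t).left =
      pullback.fst (fermatHypersurface 1 m).hom W.hom ⁻¹' {q t (IsLocalRing.closedPoint ℂ)} := fun t ↦
    range_slice (q t) (hq1 t) W
  -- the hosts, indexed by `S × T₀`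
  have hB : IsSmoothProjective (d₁ + w) (B₁ ⊗ W) := IsSmoothProjective.tensor_holds hB₁ hW
  haveI : IsProper (B₁ ⊗ W).hom := IsSmoothProjective.isProper_holds hB
  have hfs : ∀ st : S × T₀, Flat (pullback.snd bb.left ((g st.1) ⊗ₘ (hh st.2)).left) ∧
      SmoothOfRelativeDimension 1 (pullback.snd bb.left ((g st.1) ⊗ₘ (hh st.2)).left) := fun st ↦
    flat_and_smoothOfRelativeDimension_one_snd_host X₁ ((fermatHypersurface 1 m) ⊗ W) (g st.1) (hh st.2) K₁ K₂
      (β := bb.left) hb hK₁c (hgK st.1) hK₂c (hK₂h st.2)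
  have hσex : ∀ st : S × T₀, ∃ σ₀ : pullback B₁.hom W.hom ⟶
      pullback bb.left ((g st.1) ⊗ₘ (hh st.2)).left,
      σ₀ ≫ pullback.snd bb.left ((g st.1) ⊗ₘ (hh st.2)).left = 𝟙 _ ∧
      σ₀ ≫ pullback.fst bb.left ((g st.1) ⊗ₘ (hh st.2)).left =
        (pullback.map B₁.hom W.hom X₁.hom W.hom (g st.1).left (𝟙 _) (𝟙 _)
          (hom_comp_id_eq_left_comp_hom (g st.1)) (hom_comp_id_eq_id_comp_hom W)) ≫
        hb.lift (pullback.map X₁.hom W.hom X₁.hom ((fermatHypersurface 1 m) ⊗ W).hom (𝟙 _) (hh st.2).left (𝟙 _)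
          (hom_comp_id_eq_id_comp_hom X₁) (hom_comp_id_eq_left_comp_hom (hh st.2)))
          (isEffectiveCartier_tensorCentre_comap_ruling X₁ ((fermatHypersurface 1 m) ⊗ W) (hh st.2) K₁ K₂ hK₁c
            (hK₂h st.2)) ∧
      IsClosedImmersion σ₀ := fun st ↦
    exists_section_host X₁ ((fermatHypersurface 1 m) ⊗ W) (g st.1) (hh st.2) K₁ K₂ (β := bb.left) hb hK₁c (hK₂h st.2)
  choose σ₀ hσπ hσj hσci using hσex
  have hSP : ∀ st : S × T₀, IsSmoothProjective (d₁ + w + 1)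
      (Over.mk (pullback.snd bb.left ((g st.1) ⊗ₘ (hh st.2)).left ≫ (B₁ ⊗ W).hom)) := fun st ↦
    isSmoothProjective_host X₁ ((fermatHypersurface 1 m) ⊗ W) (g st.1) (hh st.2) K₁ K₂ bb hb hZ.isProjectiveOver hB
      hK₁c (hgK st.1) hK₂c (hK₂h st.2)
  -- ranges
  have hrange_i : ∀ st : S × T₀, Set.range ((g st.1) ⊗ₘ (hh st.2)).left =
      pullback.fst X₁.hom ((fermatHypersurface 1 m) ⊗ W).hom ⁻¹' Set.range (g st.1).left ∩
        pullback.snd X₁.hom ((fermatHypersurface 1 m) ⊗ W).hom ⁻¹' Set.range (hh st.2).left := fun st ↦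
    Scheme.Pullback.range_map B₁.hom W.hom X₁.hom ((fermatHypersurface 1 m) ⊗ W).hom (g st.1).left (hh st.2).left (𝟙 _)
      (hom_comp_id_eq_left_comp_hom (g st.1)) (hom_comp_id_eq_left_comp_hom (hh st.2))
  have hrange_j : ∀ st : S × T₀, Set.range (pullback.fst bb.left ((g st.1) ⊗ₘ (hh st.2)).left) =
      bb.left ⁻¹' Set.range ((g st.1) ⊗ₘ (hh st.2)).left := fun st ↦
    Scheme.Pullback.range_fst _ _
  have hmem_hh : ∀ t (y : ↑(pullback (fermatHypersurface 1 m).hom W.hom)), y ∈ Set.range (hh t).left ↔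
      pullback.fst (fermatHypersurface 1 m).hom W.hom y = q t (IsLocalRing.closedPoint ℂ) := fun t y ↦ by
    rw [hrange_hh]; rfl
  haveI hici : ∀ st : S × T₀, IsClosedImmersion ((g st.1) ⊗ₘ (hh st.2)).left := fun st ↦
    isClosedImmersion_tensorHom_left _ _
  -- the hosts as `ℂ`-schemes
  let Eh : S × T₀ → SchemeOver ℂ := fun st ↦
    Over.mk (pullback.snd bb.left ((g st.1) ⊗ₘ (hh st.2)).left ≫ (B₁ ⊗ W).hom)
  have hσover : ∀ st, σ₀ st ≫ (Eh st).hom = (B₁ ⊗ W).hom := fun st ↦ by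
    change σ₀ st ≫ (pullback.snd bb.left ((g st.1) ⊗ₘ (hh st.2)).left ≫ (B₁ ⊗ W).hom) = _
    rw [← Category.assoc, hσπ st]
    exact Category.id_comp _
  haveI hσci' : ∀ st, @IsClosedImmersion (B₁ ⊗ W).left (Eh st).left (σ₀ st) := fun st ↦ hσci st
  refine ⟨Z, hZ, bb, hb, hbir, centreCompl _, hiso, S × T₀, inferInstance, Eh, hSP,
    fun st ↦ Over.homMk (pullback.snd bb.left ((g st.1) ⊗ₘ (hh st.2)).left) rfl,
    fun st ↦ (hfs st).1,
    fun st ↦ Over.homMk (σ₀ st) (hσover st),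
    fun st ↦ hσci' st,
    fun st ↦ Over.homMk (pullback.fst bb.left ((g st.1) ⊗ₘ (hh st.2)).left)
      (fst_comp_hom_eq bb ((g st.1) ⊗ₘ (hh st.2))),
    fun st ↦ inferInstanceAs (IsClosedImmersion (pullback.fst bb.left ((g st.1) ⊗ₘ (hh st.2)).left)),
    fun st ↦ (g st.1) ⊗ₘ (hh st.2), hici,
    fun st ↦ Over.OverMorphism.ext (pullback.condition), ?_, ?_, ?_⟩
  · -- disjoint images
    intro st st' hne
    change Disjoint (Set.range (pullback.fst bb.left ((g st.1) ⊗ₘ (hh st.2)).left))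
      (Set.range (pullback.fst bb.left ((g st'.1) ⊗ₘ (hh st'.2)).left))
    rw [hrange_j, hrange_j, hrange_i, hrange_i]
    refine Set.disjoint_iff.mpr fun z ⟨⟨h1z, h2z⟩, ⟨h1z', h2z'⟩⟩ ↦ hne (Prod.ext ?_ ?_)
    · by_contra hs
      exact Set.disjoint_iff.mp (hgdisj hs) ⟨h1z, h1z'⟩
    · exact hqinj (((hmem_hh _ _).mp h2z).symm.trans ((hmem_hh _ _).mp h2z'))
  · -- the exceptional locus is covered by the hosts
    change (bb.left ⁻¹' ((K₁.comap (pullback.fst X₁.hom ((fermatHypersurface 1 m) ⊗ W).hom) ⊔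
      K₂.comap (pullback.snd X₁.hom ((fermatHypersurface 1 m) ⊗ W).hom)).support :
        Set ↑(pullback X₁.hom ((fermatHypersurface 1 m) ⊗ W).hom))ᶜ)ᶜ = _
    rw [Set.preimage_compl, compl_compl, support_tensorCentre]
    have hmemK₂ := mem_support_ker_fermatSection_whiskerRight hm W (Fin.last 2)
    ext z
    simp only [Set.mem_preimage, Set.mem_iUnion]
    constructor
    · rintro ⟨hz1, hz2⟩
      obtain ⟨s, hs⟩ := Set.mem_iUnion.mp (hgcov hz1)
      have hz2' : pullback.fst (fermatHypersurface 1 m).hom W.hom (pullback.snd X₁.hom ((fermatHypersurface 1 m) ⊗ W).hom (bb.left z)) ∈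
          fermatCoordHyperplane 1 m (Fin.last 2) := (hmemK₂ _).mp hz2
      obtain ⟨t, ht⟩ := hqcov _ hz2'
      refine ⟨(s, t), ?_⟩
      change z ∈ Set.range (pullback.fst bb.left ((g (s, t).1) ⊗ₘ (hh (s, t).2)).left)
      rw [hrange_j (s, t), Set.mem_preimage, hrange_i (s, t)]
      exact ⟨hs, (hmem_hh t _).mpr ht.symm⟩
    · rintro ⟨st, hst⟩
      have hst' : z ∈ Set.range (pullback.fst bb.left ((g st.1) ⊗ₘ (hh st.2)).left) := hst
      rw [hrange_j, Set.mem_preimage, hrange_i] at hst'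
      obtain ⟨hs, ht⟩ := hst'
      exact ⟨Scheme.IdealSheafData.support_antitone (le_ker_of_comap_eq_bot _ _ (hgK st.1))
          ((g st.1).left.range_subset_ker_support hs),
        Scheme.IdealSheafData.support_antitone (le_ker_of_comap_eq_bot _ _ (hK₂h st.2))
          ((hh st.2).left.range_subset_ker_support ht)⟩
  · -- cohomology of the hosts off the section
    intro st a e
    haveI : CompactSpace (ComplexPoints (B₁ ⊗ W)) := compactSpace_algPoints_of_isProper_holds _ ℂ
    haveI : T2Space (ComplexPoints (B₁ ⊗ W)) :=
      Literature.NumberTheory.Transcendental.t2Space_algPoints_holds (B₁ ⊗ W) ℂ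
    haveI := hσci st
    let O : (pullback bb.left ((g st.1) ⊗ₘ (hh st.2)).left).Opens :=
      (⟨Set.range (σ₀ st), @isClosed_range_section _ _ _ bb.left ((g st.1) ⊗ₘ (hh st.2)).left
          (σ₀ st) (hσci st)⟩ : TopologicalSpace.Closeds _).compl
    let Eo : SchemeOver ℂ := Over.mk (O.ι ≫ (Eh st).hom)
    let u : Eo ⟶ Eh st := Over.homMk O.ι rfl
    haveI : IsOpenImmersion u.left := inferInstanceAs (IsOpenImmersion O.ι)
    have hu : Set.range u.left.base = (Set.range (σ₀ st).base)ᶜ := Scheme.Opens.range_ι O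
    exact exists_restrictCompl_sub_map_eq_zero_of_polynomial_charts (E := Eh st) (P := B₁ ⊗ W)
      (Eo := Eo) (Over.homMk (pullback.snd bb.left ((g st.1) ⊗ₘ (hh st.2)).left) rfl)
      (Over.homMk (σ₀ st) (hσover st)) u hu
      (fun x ↦ @exists_polynomial_chart_host ℂ _ X₁ ((fermatHypersurface 1 m) ⊗ W) _ _ (g st.1) (hh st.2) K₁ K₂ _
        bb.left hb _ _ hK₁c (hgK st.1) hK₂c (hK₂h st.2) (σ₀ st) (hσci st) (hσj st) x) a e

end Package

end Literature.AlgebraicGeometry.HodgeTheory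

end
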